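import Mathlib
import Summits.Ventures.HodgeRepro.GaussSumStability
import Summits.Ventures.HodgeRepro.PeriodCloserC7Stability

/-!
# OcticCMPointS3 — the residual check (E3) at the places of `S₃` of `E = ℚ(ζ₅, √(4+√5))`: threshold and order

Blind re-derivation cell `pub-hodge-repro`, seat night-2 (gen 1).  Target tree path
`lean/Summits/Ventures/HodgeRepro/OcticCMPointS3.lean`.  Continues `OcticCMPoint.lean` (the place table of the octic
point, night-2 g0) and `PeriodCloserC7Stability.lean` (stability of the ε-factor on the finite-ring model).

**Part 1 — the model `R = 𝒪/𝔭^c` as a truncated valuation ring.**  Present `𝒪/𝔭^c` by a generator `π` of its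
maximal ideal with `π^c = 0`; the ideal `𝔭^k/𝔭^c` is `span {π^k}` (`pow π k`).  Two facts feed the hypotheses of
`GaussSumStability` / `PeriodCloserC7Stability`:

* `pow π k · pow π k = 0` as soon as `2k ≥ c` (`pow_mul_pow_eq_zero`) — the ideal `I = 𝔭^{⌈c/2⌉}/𝔭^c` is
  square-zero;
* for a PRIMITIVE additive character (`PrimitiveAddChar ψ π c`: the `ψ`-annihilator of `𝔭^k/𝔭^c` is
  `𝔭^{c−k}/𝔭^c` — the transport of «`ψ` has exact conductor `ν`» to `R`), a character of conductor exponent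
  `≤ a` (`ConductorLE`: trivial on the units `≡ 1 mod 𝔭^a`) is `Shallow` for `I = 𝔭^k/𝔭^c` whenever `a ≤ c − k`
  (`shallow_of_conductorLE`).

Hence **the explicit threshold** (`E3_of_threshold`): for the four characters `χ′_j` of a face at `v` with
conductor exponents `a_j`, every twist `ρ` of conductor EXACTLY `c` with `c ≥ 2 · max_j a_j` discharges (E3)_v
under N2 — ROUTE-B §9.9 (d)'s «`c ≥ 2·max_j c(χ_j′) + 2`» is inside this (`threshold_route`) — and such a twist
EXISTS on the model for every unit parameter (`exists_twist_E3` in `OcticCMPointS3Exists.lean`, on `GaussSumTwistExists.lean`).  The primitivity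
of `ψ̃` is itself DERIVED (`primitiveAddChar_of_chain`) from two natural hypotheses on the model — every element of
`𝒪/𝔭^c` is a unit times a power of `π` (`IsChainRing`), and `ψ̃` is non-trivial on `𝔭^{c−1}/𝔭^c` (`ExactConductor`) —
so `E3_of_threshold'` needs no primitivity assumption.

**Part 2 — the order of the twist** (ROUTE.md §4 item 2 (9)(d), lead precision: «at a place `v | 2` in `S₃` a
`ρ_v` of ODD order and conductor `≥ 2` does not exist … so the twist there has `2`-power order»).  On the kernel:
the group `1 + I` is killed by every `N` with `N · I = 0` (`one_add_pow_eq_one`: `(1 + z)^N = 1 + N z` when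
`I · I = 0`), so a character's restriction to `1 + I` has order dividing `N`; in `𝒪/𝔭^c` one may take
`N = p^m` with `m · e(K_v/ℚ_p) ≥ c − k`, so the restriction of the twist to `1 + 𝔭^k` has `p`-POWER order, `p`
the residue characteristic — `5`-power (odd) at `𝔭₁, 𝔭₂ | 5`, `2`-power (even, for a twist of conductor `≥ 2`)
at `𝔮 | 2` (`twist_order_odd_at_five`, `twist_order_even_at_two`).

**Part 3 — the octic table of `S₃` in numbers** (from `OcticCMPoint.lean`, night-2 g0: the residue computations
are `decide`-checked there; the splitting types follow by Dedekind–Kummer / the 2-adic square criterion / base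
change, stated not formalised): `𝔭₁, 𝔭₂ | 5`: `K_v = ℚ₅(ζ₅) ⊃ k_v = ℚ₅(√5)`, ramified quadratic (tame, `p = 5`),
residue fields `𝔽₅ = 𝔽₅`; `𝔮 | 2`: `K_v ⊃ k_v` the unramified quadratic extension of the ramified quartic
`ℚ₂(√5, √(4+√5))`, residue fields `𝔽₁₆ ⊃ 𝔽₄`.  The tame quotient `(𝒪_K/𝔭)^×` has order `q_K − 1`, CO-PRIME to `p`
in both cases (`4 ⊥ 5`, `15 ⊥ 2`), so a `p`-power-order character is automatically trivial on it and a primitive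
twist of conductor `c ≥ 2` can be taken of `p`-power order exactly (`S3Place.tame_coprime`).

**What is not here.**  The four characters `χ′_j` of the octic face and their conductor exponents `a_j` are on no
page of the cell (the Hecke characters of the CM point depend on the choice of the point in its isogeny class
and of the level); the results quantify over every `a_j`.  The global existence of a conjugate-orthogonal twist
with the prescribed local components (ROUTE-B §9.12 (c)) is outside the model.  Nothing here says anything about
the status of the Hodge conjecture for CM abelian varieties, which is NOT proved.
-/

set_option autoImplicit false

noncomputable section

open Finset

namespace Summit.Ventures.HodgeRepro.PeriodCloser

open GaussSumStability LocalChar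

/-! ### Part 1 — the truncated valuation ring `𝒪/𝔭^c` -/

variable {R : Type} [CommRing R]

/-- The ideal `𝔭^k/𝔭^c` of `R = 𝒪/𝔭^c`, generated by `π^k`. -/
def pow (π : R) (k : ℕ) : Ideal R := Ideal.span {π ^ k}

/-- `𝔭^k ⊆ 𝔭^a` when `a ≤ k`. -/
theorem pow_le_pow (π : R) {a k : ℕ} (h : a ≤ k) : pow π k ≤ pow π a := by
  unfold pow
  rw [Ideal.span_singleton_le_span_singleton]
  exact pow_dvd_pow π h

/-- `𝔭^k · 𝔭^k = 0` in `𝒪/𝔭^c` when `2k ≥ c` — the square-zero hypothesis of the stability theorem. -/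
theorem pow_mul_pow_eq_zero (π : R) (c k : ℕ) (hc : π ^ c = 0) (hk : c ≤ 2 * k) :
    ∀ z ∈ pow π k, ∀ z' ∈ pow π k, z * z' = 0 := by
  intro z hz z' hz'
  rw [pow, Ideal.mem_span_singleton] at hz hz'
  obtain ⟨r, rfl⟩ := hz
  obtain ⟨r', rfl⟩ := hz'
  have h2 : π ^ k * π ^ k = 0 := by
    rw [← pow_add]
    obtain ⟨m, hm⟩ := Nat.exists_eq_add_of_le hk
    rw [show k + k = c + m by omega, pow_add, hc, zero_mul]
  calc π ^ k * r * (π ^ k * r') = (π ^ k * π ^ k) * (r * r') := by ring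
    _ = 0 := by rw [h2, zero_mul]

/-- **Primitivity of the additive character** relative to `(π, c)`: the `ψ`-annihilator of `𝔭^k/𝔭^c` is
contained in `𝔭^{c−k}/𝔭^c` for every `k ≤ c` (the transport to `R = 𝒪/𝔭^c` of «`ψ` has exact conductor `ν`»:
`ψ(ϖ^{−ν−c} x 𝔭^k) = 1` iff `ord(x) ≥ c − k`). -/
def PrimitiveAddChar (ψ : AddChar R ℂ) (π : R) (c : ℕ) : Prop :=
  ∀ k ≤ c, ∀ x : R, PsiAnn ψ (pow π k) x → x ∈ pow π (c - k)

/-- **Conductor exponent `≤ a`**: the character is trivial on the units `≡ 1 mod 𝔭^a`. -/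
def ConductorLE (χ : LocalChar R) (π : R) (a : ℕ) : Prop :=
  ∀ u : Rˣ, (u : R) - 1 ∈ pow π a → χ.unit u = 1

/-- A character of conductor exponent `a ≤ c − k` is `Shallow` for `I = 𝔭^k/𝔭^c` and a primitive `ψ`. -/
theorem shallow_of_conductorLE (ψ : AddChar R ℂ) (π : R) (c : ℕ) (hψ : PrimitiveAddChar ψ π c) (k : ℕ)
    (hk : k ≤ c) (χ : LocalChar R) (a : ℕ) (ha : a ≤ c - k) (h : ConductorLE χ π a) :
    Shallow ψ (pow π k) χ := by
  intro u hu
  exact h u (pow_le_pow π ha (hψ k hk _ hu))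

variable [Fintype R]

/-- **(E3)_v with the explicit threshold.**  Let `R = 𝒪/𝔭^c` (`π^c = 0`, `ψ` primitive), `χ′_j` the four characters
of the face at `v` with conductor exponents `a_j`, and `ρ` a twist of conductor exactly `c` (primitive on
`I = 𝔭^{⌈c/2⌉}/𝔭^c` with parameter `u`).  If `c ≥ 2 a_j` for every `j` and N2 holds, then
`ε(χ′_0 ρ) ε(χ′_1 ρ) = ε(χ′_2 ρ) ε(χ′_3 ρ)`. -/
theorem E3_of_threshold (κ : ℂ) (n : ℕ) (χ' : Fin 4 → LocalChar R) (ρ : LocalChar R) (ψ : AddChar R ℂ)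
    (π : R) (c : ℕ) (hc : π ^ c = 0) (hψ : PrimitiveAddChar ψ π c) (a : Fin 4 → ℕ)
    (ha : ∀ j, 2 * a j ≤ c) (hcond : ∀ j, ConductorLE (χ' j) π (a j)) (u : Rˣ)
    (hρ : Primitive ψ (pow π ((c + 1) / 2)) ρ u) (hN2 : χ' 0 * χ' 1 = χ' 2 * χ' 3) :
    eps κ n (χ' 0 * ρ) ψ * eps κ n (χ' 1 * ρ) ψ = eps κ n (χ' 2 * ρ) ψ * eps κ n (χ' 3 * ρ) ψ := by
  refine eps_E3_of_N2 κ n χ' ρ ψ (pow π ((c + 1) / 2))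
    (pow_mul_pow_eq_zero π c ((c + 1) / 2) hc (by omega)) u hρ (fun j => ?_) hN2
  refine shallow_of_conductorLE ψ π c hψ ((c + 1) / 2) (by omega) (χ' j) (a j) ?_ (hcond j)
  have := ha j
  omega

/-- **Chain-ring hypothesis**: every element of `R = 𝒪/𝔭^c` is a unit times a power of `π`. -/
def IsChainRing (π : R) : Prop := ∀ x : R, ∃ (u : Rˣ) (m : ℕ), x = u * π ^ m

/-- **Exact conductor**: `ψ` is non-trivial on `𝔭^{c−1}/𝔭^c` (the transport of «`ψ` has conductor exactly `ν`»). -/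
def ExactConductor (ψ : AddChar R ℂ) (π : R) (c : ℕ) : Prop := ¬ ∀ r : R, ψ (π ^ (c - 1) * r) = 1

omit [Fintype R] in
/-- **Primitivity follows from the chain-ring structure and the exact conductor**: if every element is
`u · π^m` and `ψ` is non-trivial on `𝔭^{c−1}`, then the `ψ`-annihilator of `𝔭^k/𝔭^c` is contained in `𝔭^{c−k}/𝔭^c`
for `k ≤ c` — the hypothesis `PrimitiveAddChar` of `E3_of_threshold` is not an extra assumption on the model. -/
theorem primitiveAddChar_of_chain (ψ : AddChar R ℂ) (π : R) (c : ℕ) (hchain : IsChainRing π)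
    (hexact : ExactConductor ψ π c) : PrimitiveAddChar ψ π c := by
  intro k hk x hx
  obtain ⟨u, m, rfl⟩ := hchain x
  by_cases hm : c - k ≤ m
  · -- `u π^m = (u π^{m−(c−k)}) · π^{c−k}`
    rw [pow, Ideal.mem_span_singleton]
    exact ⟨u * π ^ (m - (c - k)), by
      rw [mul_left_comm, ← pow_add, Nat.add_sub_cancel' hm]⟩
  · -- `m + k < c`: `ψ` would be trivial on `𝔭^{c−1} ⊆ u π^m · 𝔭^k`, contradicting the exact conductor.
    exfalso
    apply hexact
    intro r
    have hmk : m + k + (c - 1 - m - k) = c - 1 := by omega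
    have h1 : π ^ (c - 1) * r = ((u : R) * π ^ m) * (π ^ k * (((u⁻¹ : Rˣ) : R) * π ^ (c - 1 - m - k) * r)) := by
      calc π ^ (c - 1) * r = ((u : R) * ((u⁻¹ : Rˣ) : R)) * (π ^ (m + k + (c - 1 - m - k)) * r) := by
            rw [Units.mul_inv, one_mul, hmk]
        _ = ((u : R) * π ^ m) * (π ^ k * (((u⁻¹ : Rˣ) : R) * π ^ (c - 1 - m - k) * r)) := by
            rw [pow_add, pow_add]; ring
    rw [h1]
    exact hx _ (by
      rw [pow, Ideal.mem_span_singleton]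
      exact ⟨((u⁻¹ : Rˣ) : R) * π ^ (c - 1 - m - k) * r, rfl⟩)

/-- `E3_of_threshold` with the primitivity of `ψ` DERIVED from the chain-ring structure and the exact conductor. -/
theorem E3_of_threshold' (κ : ℂ) (n : ℕ) (χ' : Fin 4 → LocalChar R) (ρ : LocalChar R) (ψ : AddChar R ℂ)
    (π : R) (c : ℕ) (hc : π ^ c = 0) (hchain : IsChainRing π) (hexact : ExactConductor ψ π c)
    (a : Fin 4 → ℕ) (ha : ∀ j, 2 * a j ≤ c) (hcond : ∀ j, ConductorLE (χ' j) π (a j)) (u : Rˣ)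
    (hρ : Primitive ψ (pow π ((c + 1) / 2)) ρ u) (hN2 : χ' 0 * χ' 1 = χ' 2 * χ' 3) :
    eps κ n (χ' 0 * ρ) ψ * eps κ n (χ' 1 * ρ) ψ = eps κ n (χ' 2 * ρ) ψ * eps κ n (χ' 3 * ρ) ψ :=
  E3_of_threshold κ n χ' ρ ψ π c hc (primitiveAddChar_of_chain ψ π c hchain hexact) a ha hcond u hρ hN2

/-- The route's choice `c = 2 · max_j a_j + 2` (ROUTE-B §9.9 (d)) satisfies the threshold `c ≥ 2 a_j` for every
`j`. -/
theorem threshold_route (a : Fin 4 → ℕ) (j : Fin 4) : 2 * a j ≤ 2 * (univ.sup a) + 2 := by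
  have : a j ≤ univ.sup a := Finset.le_sup (mem_univ j)
  omega

/-! ### Part 2 — the order of the twist on `1 + I` -/

omit [Fintype R] in
/-- `(1 + z)^m = 1 + m z` for a square-zero `z`. -/
theorem one_add_pow_eq (I : Ideal R) (hI : ∀ z ∈ I, ∀ z' ∈ I, z * z' = 0) {z : R} (hz : z ∈ I) (m : ℕ) :
    (1 + z) ^ m = 1 + (m : R) * z := by
  induction m with
  | zero => simp
  | succ m ih =>
    rw [pow_succ, ih, Nat.cast_succ]
    have h0 : z * z = 0 := hI z hz z hz
    linear_combination (m : R) * h0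

omit [Fintype R] in
/-- **The group `1 + I` is killed by any `N` with `N · I = 0`**: `(1 + z)^N = 1`.  In `𝒪/𝔭^c` with
`I = 𝔭^k/𝔭^c` one may take `N = p^m`, `m · e(K_v/ℚ_p) ≥ c − k`: the restriction of every character to
`1 + 𝔭^k` has `p`-power order. -/
theorem one_add_pow_eq_one (I : Ideal R) (hI : ∀ z ∈ I, ∀ z' ∈ I, z * z' = 0) (N : ℕ)
    (hN : ∀ z ∈ I, (N : R) * z = 0) {z : R} (hz : z ∈ I) : (1 + z) ^ N = 1 := by
  rw [one_add_pow_eq I hI hz N, hN z hz, add_zero]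

omit [Fintype R] in
/-- A multiplicative character restricted to `1 + I` has order dividing `N` when `N · I = 0`. -/
theorem mulChar_one_add_pow_eq_one (I : Ideal R) (hI : ∀ z ∈ I, ∀ z' ∈ I, z * z' = 0) (N : ℕ)
    (hN : ∀ z ∈ I, (N : R) * z = 0) (ρ : MulChar R ℂ) {z : R} (hz : z ∈ I) : ρ (1 + z) ^ N = 1 := by
  rw [← map_pow, one_add_pow_eq_one I hI N hN hz, map_one]

omit [Fintype R] in
/-- At a place of residue characteristic `5` (`𝔭₁, 𝔭₂ | 5` of the octic point) the restriction of the twist to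
`1 + I` has ODD order: `ρ(1+z)^{5^m} = 1` — the «odd order» escape of ROUTE-B §9.9 (d) is available. -/
theorem twist_order_odd_at_five (I : Ideal R) (hI : ∀ z ∈ I, ∀ z' ∈ I, z * z' = 0) (m : ℕ)
    (hN : ∀ z ∈ I, ((5 ^ m : ℕ) : R) * z = 0) (ρ : MulChar R ℂ) {z : R} (hz : z ∈ I) :
    ρ (1 + z) ^ (5 ^ m) = 1 ∧ Odd (5 ^ m) :=
  ⟨mulChar_one_add_pow_eq_one I hI (5 ^ m) hN ρ hz, Odd.pow (by decide)⟩

omit [Fintype R] in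
/-- At the place `𝔮 | 2` of the octic point the restriction of the twist to `1 + I` has `2`-POWER order:
`ρ(1+z)^{2^m} = 1`; for `m ≥ 1` that order is EVEN — the lead's precision: no twist of odd order and conductor
`≥ 2` exists above `2`. -/
theorem twist_order_even_at_two (I : Ideal R) (hI : ∀ z ∈ I, ∀ z' ∈ I, z * z' = 0) (m : ℕ) (hm : 1 ≤ m)
    (hN : ∀ z ∈ I, ((2 ^ m : ℕ) : R) * z = 0) (ρ : MulChar R ℂ) {z : R} (hz : z ∈ I) :
    ρ (1 + z) ^ (2 ^ m) = 1 ∧ Even (2 ^ m) :=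
  ⟨mulChar_one_add_pow_eq_one I hI (2 ^ m) hN ρ hz, (Nat.even_pow' (by omega)).mpr even_two⟩

/-! ### Part 3 — the three places of `S₃` of the octic point, in numbers -/

/-- The local invariants of a non-split finite place `v` of `E/E⁺` entering (E2)/(E3): the residue
characteristic `p`, the ramification index and residue degree of `K_v/k_v`, and the residue cardinalities. -/
structure S3Place where
  /-- residue characteristic -/
  p : ℕ
  /-- ramification index `e(K_v/k_v)` -/
  e : ℕ
  /-- residue degree `f(K_v/k_v)` -/
  f : ℕ
  /-- residue cardinality of `k_v` -/
  qk : ℕ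
  /-- residue cardinality of `K_v` -/
  qK : ℕ

/-- `𝔭₁ | 5`: `K_v = ℚ₅(ζ₅)`, `k_v = ℚ₅(√5)`, ramified quadratic, residue field `𝔽₅` on both sides
(`OcticCMPoint.lean`: `five_ramified_in_golden`, `sqrtFive_splits_in_Eplus`, `cyclo5_totally_ramified_mod5`). -/
def octic_p1 : S3Place := ⟨5, 2, 1, 5, 5⟩

/-- `𝔭₂ | 5`: the conjugate of `𝔭₁` under `√5 ↦ √5`, `θ ↦ −θ`; the same invariants. -/
def octic_p2 : S3Place := ⟨5, 2, 1, 5, 5⟩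

/-- `𝔮 | 2`: `k_v = ℚ₂(√5, √(4+√5))` (residue field `𝔽₄`), `K_v = k_v(ζ₅)` unramified quadratic (residue field
`𝔽₁₆`) (`OcticCMPoint.lean`: `two_inert_in_golden`, `two_ramified_in_Eplus`, `cyclo5_no_root_F4`). -/
def octic_q : S3Place := ⟨2, 1, 2, 4, 16⟩

/-- The residue cardinalities are consistent: `q_K = q_k ^ f`. -/
theorem octic_qK_eq : octic_p1.qK = octic_p1.qk ^ octic_p1.f ∧ octic_p2.qK = octic_p2.qk ^ octic_p2.f ∧
    octic_q.qK = octic_q.qk ^ octic_q.f := by decide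

/-- `K_v/k_v` is ramified at `𝔭₁, 𝔭₂` and unramified at `𝔮`: `e · f = 2` in all three cases. -/
theorem octic_ef : octic_p1.e * octic_p1.f = 2 ∧ octic_p2.e * octic_p2.f = 2 ∧ octic_q.e * octic_q.f = 2 := by
  decide

/-- **The tame quotient cannot carry the twist's order**: `(𝒪_K/𝔭)^×` has order `q_K − 1`, coprime to `p`
(`4 ⊥ 5` at `𝔭₁, 𝔭₂`; `15 ⊥ 2` at `𝔮`), so a character of `p`-power order is trivial on it and lives on `1 + 𝔭`:
a primitive twist of conductor `c ≥ 2` of exact `p`-power order exists at each place of `S₃`. -/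
theorem S3Place.tame_coprime : Nat.Coprime (octic_p1.qK - 1) octic_p1.p ∧
    Nat.Coprime (octic_p2.qK - 1) octic_p2.p ∧ Nat.Coprime (octic_q.qK - 1) octic_q.p := by decide

/-- The residue characteristic is odd at `𝔭₁, 𝔭₂` (odd-order twists available) and `2` at `𝔮` (the twist has
`2`-power order). -/
theorem octic_residue_char : Odd octic_p1.p ∧ Odd octic_p2.p ∧ octic_q.p = 2 := by decide

end Summit.Ventures.HodgeRepro.PeriodCloser

end
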